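import Summits.BirchSwinnertonDyer.Rank1Residual.Ordinary.DepthLawFromKolyvaginClass
import HarnessLib

/-!
# The KOLYVAGIN-CLASS DATUM: the one remaining input of the depth-law / C-16 derivation, TYPED as a `Prop`
# (definition with body + consumers; NOTHING asserted, no named fact; C-16 stays a CONJECTURE)

HONEST FRAMING (cell `b2b-bsdres`, run/shared/lean/b2b/bsd-rank1-residual/, verbatim in every
file): the goal of the cell is to DELETE the COMBINATION-SHAPED residual classes of the
Birch–Swinnerton-Dyer formula for ALL analytic-rank `≤ 1` elliptic curves over `ℚ` — "full BSD
formula for every rank `≤ 1` curve in class `C`" assembled STRICTLY from published theorems — so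
that the rank-`≤ 1` remainder becomes exactly the CONSTRUCTION-SHAPED classes, which are TYPED
(missing-input `Prop`s), NOT attempted. This is not "finishing BSD". Seat `b2b-bsdres-additive-p3`
(X8 prover B / X7 joint; typer-designate for the cell conjecture C-16 = hyp C120.1 by hyp R-16 (e)).
This file books nothing and moves no mark; X7 / X8 stay CONSTRUCTION-SHAPED; C-16 = CONJECTURE.

## What this file does

After `Ordinary/DepthLawFromKolyvaginClass.lean` and `Conjectures/KuriharaExactOrderFromPoitouTate.lean`, the per-level
input of the depth-law derivation (`R1-DEPTH-LAW.md` §2) is exactly the Kolyvagin-system class with its KS relation and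
Kim's reading. This file NAMES that input — an `@[conjecture]`-tagged `Prop`-valued definition with a body (a hypothesis
schema = the TYPED missing input, OPEN at `p = 3`; not a fact, nothing asserted):

* `KolyvaginKimDatum W f p ℓ k n Q vℓ vp ψ` := there is a class `x ∈ H¹(ℚ, E[p^n])` with the Kummer condition at every
  place `∉ {vℓ, vp}` (`kummerOutside`), an additive isomorphism `θ : 𝓛_{vℓ} ≅ H¹(ℚ_{vℓ}, E[p^n]) ⧸ 𝓛_{vℓ}` with
  `[loc_{vℓ} x] = θ[loc_{vℓ} κ_{p^n}(Q)]` (the KS relation to `κ₁ = κ(Q)`, `Q = p^a u·P`), and Kim's reading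
  `ord_p(δ̃_ℓ mod p^k) = min(k, ord_p ψ_p[loc_{vp} x])` for every identification `ψ_p` of the singular quotient at `vp`
  (Kato's Kolyvagin system for `(E[p^n], 𝓕_can, 𝒫_n)` — Mazur–Rubin Thm. 3.2.4 with Thm. 5.2.12 — and Kim 2022
  Thm. 3.13 + (5.3), printed for `p ≥ 5`; at `p = 3` the cell's OPEN range extension);
* §0/§2 the comparison clause is INTRINSIC: in `ℤ/p^n` equal `ord_p` ⟺ related by a unit ⟺ related by SOME additive
  isomorphism of any two groups identified with `ℤ/p^n` (`ReciprocityPT.exists_addEquiv_apply_eq_iff_zmodPowOrd_eq`), so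
  `KolyvaginKimDatum … ↔ ∃ x Kummer outside {vℓ, vp}, ord_p ψ_ℓ[loc_ℓ x] = ord_p φ(loc_ℓ κ(Q)) ∧ Kim's reading`
  (`kolyvaginKimDatum_iff_zmodPowOrd_eq`) — the KS relation enters only through the order of the singular part of
  `loc_ℓ κ_ℓ` (= `min(n, a + v_ℓ(P))` by `LocalClassOrders`);
* consumers, one line each from the two files above: `zmodPowOrd_kuriharaNumber_eq_of_kolyvaginKimDatum` (LAW-2 at
  `(ℓ, k)` in the derived regime, any odd good non-anomalous `p`, any `m_p`), `kuriharaExactOrderAt_of_kolyvaginKimDatum`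
  (C-16's clause on its letter) and the closed sentence `kuriharaExactOrderRankOneAtThree_of_kolyvaginKimDatum`:
  **C-16 ⟸ (Poitou–Tate over `ℚ`) ∧ (local Euler characteristic at every `ℚ_v`) ∧ (∀ letter, ∀ ψ, ∃ n ≥ k, ℓ ∈ 𝒫_n,
  ∃ u, 3 ∤ u, `KolyvaginKimDatum W D.f 3 ℓ k n ((3^F·u)·P) vℓ v₃ ψ`)** with `F = s + v₃ ∏ c_q`.

References: `R1-DEPTH-LAW.md` §2; `HOME/b2b-bsdres-additive-p3/KS-LAYER-SPEC.md`; B. Mazur, K. Rubin, Mem. AMS 799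
(2004), Def. 3.2.1, Thm. 3.2.4, Thm. 5.2.12 [MazurRubin2004]; C.-H. Kim, arXiv:2203.12159, Thm. 3.13, (5.3)
[Kim2022StructureSelmer]; J. S. Milne, ADT (2006), I 2.3, 2.8, 4.10(b) [MilneADT2006].
-/

noncomputable section

open scoped Classical MatrixGroups ModularForm

open CongruenceSubgroup WeierstrassCurve Literature.NumberTheory.EllipticCurves
  Literature.NumberTheory.EllipticCurves.ModularForms
  Literature.NumberTheory.EllipticCurves.Rank1Residual
  Literature.NumberTheory.GaloisRepresentations Literature.NumberTheory.GaloisCohomology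
  Function NumberField IsDedekindDomain

namespace Summit.BirchSwinnertonDyer.Rank1Residual.Ordinary

/-! ### §0 Algebra: equal `ord_p` ⟺ related by a unit ⟺ related by an identification (the KS relation is intrinsic) -/

section Order

variable {p : ℕ}

/-- **Normal form in `ℤ/p^n`**: every `x` is `u · p^{ord_p x}` with `u` a unit (`x.val = p^m · r`, `p ∤ r`).
[folklore] -/
theorem ReciprocityPT.exists_isUnit_mul_pow_eq (hp : p.Prime) {n : ℕ} (x : ZMod (p ^ n)) :
    ∃ u : ZMod (p ^ n), IsUnit u ∧ x = u * (p : ZMod (p ^ n)) ^ zmodPowOrd p n x := by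
  haveI : Fact p.Prime := ⟨hp⟩
  haveI : NeZero (p ^ n) := ⟨pow_ne_zero n hp.ne_zero⟩
  by_cases hx : x = 0
  · subst hx
    refine ⟨1, isUnit_one, ?_⟩
    rw [zmodPowOrd_zero, one_mul, ← Nat.cast_pow, ZMod.natCast_self]
  · rw [zmodPowOrd_of_ne_zero hx]
    have hv : x.val ≠ 0 := (ZMod.val_ne_zero x).mpr hx
    obtain ⟨m, r, hr, hxr⟩ := Nat.exists_eq_pow_mul_and_not_dvd hv p hp.ne_one
    have hr0 : r ≠ 0 := by rintro rfl; exact hr (dvd_zero p)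
    have hm : padicValNat p x.val = m := by
      rw [hxr, padicValNat.mul (pow_ne_zero m hp.ne_zero) hr0, padicValNat.prime_pow,
        padicValNat.eq_zero_of_not_dvd hr, add_zero]
    have hcop : Nat.Coprime r (p ^ n) :=
      (Nat.coprime_comm.mp ((hp.coprime_iff_not_dvd).mpr hr)).pow_right n
    refine ⟨(r : ZMod (p ^ n)), (ZMod.isUnit_iff_coprime r (p ^ n)).mpr hcop, ?_⟩
    rw [hm, ← ZMod.natCast_zmod_val x, hxr, Nat.cast_mul, Nat.cast_pow, mul_comm]

/-- **Equal `ord_p` ⟹ related by a unit**: if `ord_p x = ord_p y` in `ℤ/p^n` then `y = u · x` for a unit `u`.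
[folklore] -/
theorem ReciprocityPT.exists_isUnit_mul_eq_of_zmodPowOrd_eq (hp : p.Prime) {n : ℕ} {x y : ZMod (p ^ n)}
    (h : zmodPowOrd p n x = zmodPowOrd p n y) : ∃ u : ZMod (p ^ n), IsUnit u ∧ y = u * x := by
  set m := zmodPowOrd p n x with hm
  obtain ⟨ux, hux, hx⟩ := ReciprocityPT.exists_isUnit_mul_pow_eq hp x
  obtain ⟨uy, huy, hy⟩ := ReciprocityPT.exists_isUnit_mul_pow_eq hp y
  rw [← hm] at hx
  rw [← h] at hy
  obtain ⟨vx, rfl⟩ := hux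
  refine ⟨uy * ↑vx⁻¹, huy.mul (Units.isUnit _), ?_⟩
  calc y = uy * (p : ZMod (p ^ n)) ^ m := hy
    _ = uy * ((↑vx⁻¹ : ZMod (p ^ n)) * ((vx : ZMod (p ^ n)) * (p : ZMod (p ^ n)) ^ m)) := by
        rw [← mul_assoc (↑vx⁻¹ : ZMod (p ^ n)), Units.inv_mul, one_mul]
    _ = uy * ↑vx⁻¹ * x := by rw [← hx, mul_assoc]

/-- **Two identifications with `ℤ/p^n` of any two groups differ by a unit on corresponding elements**: for
`α : A ≅ ℤ/p^n`, `β : B ≅ ℤ/p^n` and any additive isomorphism `θ : A ≅ B`, `ord_p β(θ a) = ord_p α(a)`.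
[folklore] -/
theorem ReciprocityPT.zmodPowOrd_apply_addEquiv_eq {A B : Type*} [AddCommGroup A] [AddCommGroup B] (hp : p.Prime)
    {n : ℕ} (α : A ≃+ ZMod (p ^ n)) (β : B ≃+ ZMod (p ^ n)) (θ : A ≃+ B) (a : A) :
    zmodPowOrd p n (β (θ a)) = zmodPowOrd p n (α a) := by
  haveI : NeZero (p ^ n) := ⟨pow_ne_zero n hp.ne_zero⟩
  set f : ZMod (p ^ n) ≃+ ZMod (p ^ n) := α.symm.trans (θ.trans β) with hf
  have h1 : f (α a) = β (θ a) := by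
    rw [hf, AddEquiv.trans_apply, AddEquiv.trans_apply, AddEquiv.symm_apply_apply]
  have h2 := ReciprocityPT.addMonoidHom_zmod_apply f.toAddMonoidHom (α a)
  rw [AddEquiv.coe_toAddMonoidHom, h1] at h2
  rw [h2, mul_comm, zmodPowOrd_mul_of_isUnit hp (ReciprocityPT.isUnit_addEquiv_zmod_apply_one f)]

/-- **Equal `ord_p` ⟹ related by an identification**: for `α : A ≅ ℤ/p^n`, `β : B ≅ ℤ/p^n`, `a ∈ A`, `b ∈ B` with
`ord_p α(a) = ord_p β(b)` there is an additive isomorphism `θ : A ≅ B` with `θ a = b` (`β b = u · α a` for a unit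
`u`; `θ = β⁻¹ ∘ (u ·) ∘ α`). So «`[loc_ℓ κ_ℓ] = θ(loc_ℓ κ₁)` for SOME comparison isomorphism `θ`» is EQUIVALENT to the
intrinsic «the singular part of `loc_ℓ κ_ℓ` and the finite class `loc_ℓ κ₁` have the same `p`-adic order». [folklore] -/
theorem ReciprocityPT.exists_addEquiv_apply_eq_of_zmodPowOrd_eq {A B : Type*} [AddCommGroup A] [AddCommGroup B]
    (hp : p.Prime) {n : ℕ} (α : A ≃+ ZMod (p ^ n)) (β : B ≃+ ZMod (p ^ n)) {a : A} {b : B}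
    (h : zmodPowOrd p n (α a) = zmodPowOrd p n (β b)) : ∃ θ : A ≃+ B, θ a = b := by
  haveI : NeZero (p ^ n) := ⟨pow_ne_zero n hp.ne_zero⟩
  obtain ⟨u, hu, hb⟩ := ReciprocityPT.exists_isUnit_mul_eq_of_zmodPowOrd_eq hp h
  obtain ⟨v, rfl⟩ := hu
  -- multiplication by the unit `v` as an additive automorphism of `ℤ/p^n`
  let μ : ZMod (p ^ n) ≃+ ZMod (p ^ n) :=
    { toFun := fun z => (v : ZMod (p ^ n)) * z
      invFun := fun z => (↑v⁻¹ : ZMod (p ^ n)) * z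
      left_inv := fun z => by simp only [← mul_assoc, Units.inv_mul, one_mul]
      right_inv := fun z => by simp only [← mul_assoc, Units.mul_inv, one_mul]
      map_add' := fun z w => mul_add _ _ _ }
  refine ⟨α.trans (μ.trans β.symm), ?_⟩
  rw [AddEquiv.trans_apply, AddEquiv.trans_apply, AddEquiv.symm_apply_eq, hb]
  rfl

/-- The converse direction packaged: «`∃ θ, θ a = b`» ⟺ «`ord_p α(a) = ord_p β(b)`». [folklore] -/
theorem ReciprocityPT.exists_addEquiv_apply_eq_iff_zmodPowOrd_eq {A B : Type*} [AddCommGroup A] [AddCommGroup B]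
    (hp : p.Prime) {n : ℕ} (α : A ≃+ ZMod (p ^ n)) (β : B ≃+ ZMod (p ^ n)) (a : A) (b : B) :
    (∃ θ : A ≃+ B, θ a = b) ↔ zmodPowOrd p n (α a) = zmodPowOrd p n (β b) := by
  constructor
  · rintro ⟨θ, rfl⟩
    exact (ReciprocityPT.zmodPowOrd_apply_addEquiv_eq hp α β θ a).symm
  · exact ReciprocityPT.exists_addEquiv_apply_eq_of_zmodPowOrd_eq hp α β

end Order

/-! ### §1 The datum -/

section Datum

variable (W : WeierstrassCurve ℚ) [W.IsElliptic] {N : ℕ} (f : CuspForm (Gamma0 N) 2)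
  (p ℓ k n : ℕ) [Fact p.Prime] [Fact ℓ.Prime] (Q : W.toAffine.Point) (vℓ vp : HeightOneSpectrum (𝓞 ℚ))
  (ψ : (q : ℕ) → (ZMod q)ˣ →* Multiplicative (ZMod (p ^ k)))

/-- **The Kolyvagin-class datum at `(p, ℓ, k, n)` for the point `Q` and the character `ψ`** (a HYPOTHESIS SCHEMA,
`Prop`-valued, nothing asserted): a class `x ∈ H¹(ℚ, E[p^n])` with the Kummer condition at every place outside
`{vℓ, vp}` (a Kolyvagin-system class for `𝓕_can`, relaxed at `p`), whose singular part at `vℓ` is the image of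
`loc_{vℓ} κ_{p^n}(Q)` under SOME additive isomorphism `𝓛_{vℓ} ≅ H¹(ℚ_{vℓ}, E[p^n]) ⧸ 𝓛_{vℓ}` (the KS relation
`loc^s_ℓ κ_ℓ = φ^{fs}_ℓ(loc_ℓ κ₁)` with `κ₁ = κ(Q)`), and on whose singular part at `vp` the Kurihara number reads
`ord_p(δ̃_ℓ mod p^k) = min(k, ord_p ψ_p[loc_{vp} x])` for every identification `ψ_p` (Kim's Thm. 3.13 + (5.3),
identification-blind). For Kato's class at `p = 3` (C-16's letter) this is an OPEN input — [status: open] — typed here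
as the ONE residual hypothesis of C-16's derivation (numbering / wording of the cell's conjecture list is the owner's,
hyp); at `p ≥ 5` under Mazur–Rubin's (H.0)–(H.6) it is print (Thm. 3.2.4 + Thm. 5.2.12 + Kim Thm. 3.13), not yet
typed in `Literature/`. Nothing asserted. [cite: MazurRubin2004, Def. 3.2.1, Thm. 3.2.4 and Thm. 5.2.12]
[cite: Kim2022StructureSelmer, Thm. 3.13 and (5.3)] -/
@[conjecture] def KolyvaginKimDatum : Prop :=
  ∃ (x : galoisCohomology (W.torsionGaloisModule ((p ^ n : ℕ) : ℤ)) 1)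
    (_ : x ∈ kummerOutside W (p ^ n) {Sum.inr vℓ, Sum.inr vp})
    (θ : W.kummerSelmerStructure ((p ^ n : ℕ) : ℤ) (Sum.inr vℓ) ≃+
      galoisCohomology ((W.torsionGaloisModule (p ^ n : ℕ)).toLocal (Sum.inr vℓ)) 1 ⧸
        W.kummerSelmerStructure ((p ^ n : ℕ) : ℤ) (Sum.inr vℓ)),
    (galoisCohomology.localization (W.torsionGaloisModule (p ^ n : ℕ)) (Sum.inr vℓ) 1 x :
        galoisCohomology ((W.torsionGaloisModule (p ^ n : ℕ)).toLocal (Sum.inr vℓ)) 1 ⧸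
          W.kummerSelmerStructure ((p ^ n : ℕ) : ℤ) (Sum.inr vℓ)) =
      θ ⟨_, X11b.Relaxation.localization_kummerMapTorsion_mem W (p ^ n) (Sum.inr vℓ) Q⟩ ∧
    ∀ ψp : galoisCohomology ((W.torsionGaloisModule (p ^ n : ℕ)).toLocal (Sum.inr vp)) 1 ⧸
        W.kummerSelmerStructure ((p ^ n : ℕ) : ℤ) (Sum.inr vp) ≃+ ZMod (p ^ n),
      (haveI : NeZero ℓ := ⟨(Fact.out : ℓ.Prime).ne_zero⟩
       zmodPowOrd p k (kuriharaNumber f (p ^ k) ℓ ψ)) =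
        min k (zmodPowOrd p n
          (ψp (galoisCohomology.localization (W.torsionGaloisModule (p ^ n : ℕ)) (Sum.inr vp) 1 x)))

end Datum

/-! ### §2 The datum's comparison clause is INTRINSIC -/

section Intrinsic

variable (W : WeierstrassCurve ℚ) [W.IsElliptic] {N : ℕ} (f : CuspForm (Gamma0 N) 2)
  (p ℓ k n : ℕ) [hp : Fact p.Prime] [Fact ℓ.Prime] (Q : W.toAffine.Point) (vℓ vp : HeightOneSpectrum (𝓞 ℚ))
  (ψ : (q : ℕ) → (ZMod q)ˣ →* Multiplicative (ZMod (p ^ k)))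

/-- **The comparison clause of the datum is an equality of intrinsic orders.** Given ANY identifications
`φ : 𝓛_{vℓ} ≅ ℤ/p^n` and `ψ_ℓ : H¹(ℚ_{vℓ}, E[p^n]) ⧸ 𝓛_{vℓ} ≅ ℤ/p^n` (they exist at a cyclic Kolyvagin prime of depth
`n`: `CyclicSylowQuotient` + `SingularQuotientPairing`), `KolyvaginKimDatum W f p ℓ k n Q vℓ vp ψ` holds iff there is a class
`x` Kummer outside `{vℓ, vp}` with **`ord_p ψ_ℓ[loc_{vℓ} x] = ord_p φ(loc_{vℓ} κ(Q))`** and Kim's reading (§0: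
equal orders ⟺ related by SOME additive isomorphism). With `Ordinary/LocalClassOrders.lean` the right-hand side for
`Q = (p^a u)·P` is `min(n, a + v_ℓ(P))` — the skeleton's `hxl` verbatim: the KS relation enters ONLY through the
`p`-adic order of the singular part of `loc_ℓ κ_ℓ`. [cite: MazurRubin2004, Def. 1.2.2 and Thm. 5.2.12] -/
theorem kolyvaginKimDatum_iff_zmodPowOrd_eq
    (φ : W.kummerSelmerStructure ((p ^ n : ℕ) : ℤ) (Sum.inr vℓ) ≃+ ZMod (p ^ n))
    (ψℓ : galoisCohomology ((W.torsionGaloisModule (p ^ n : ℕ)).toLocal (Sum.inr vℓ)) 1 ⧸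
        W.kummerSelmerStructure ((p ^ n : ℕ) : ℤ) (Sum.inr vℓ) ≃+ ZMod (p ^ n)) :
    KolyvaginKimDatum W f p ℓ k n Q vℓ vp ψ ↔
      ∃ (x : galoisCohomology (W.torsionGaloisModule ((p ^ n : ℕ) : ℤ)) 1)
        (_ : x ∈ kummerOutside W (p ^ n) {Sum.inr vℓ, Sum.inr vp}),
        zmodPowOrd p n (ψℓ (galoisCohomology.localization (W.torsionGaloisModule (p ^ n : ℕ)) (Sum.inr vℓ) 1 x)) =
          zmodPowOrd p n (φ ⟨_, X11b.Relaxation.localization_kummerMapTorsion_mem W (p ^ n) (Sum.inr vℓ) Q⟩) ∧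
        ∀ ψp : galoisCohomology ((W.torsionGaloisModule (p ^ n : ℕ)).toLocal (Sum.inr vp)) 1 ⧸
            W.kummerSelmerStructure ((p ^ n : ℕ) : ℤ) (Sum.inr vp) ≃+ ZMod (p ^ n),
          (haveI : NeZero ℓ := ⟨(Fact.out : ℓ.Prime).ne_zero⟩
           zmodPowOrd p k (kuriharaNumber f (p ^ k) ℓ ψ)) =
            min k (zmodPowOrd p n
              (ψp (galoisCohomology.localization (W.torsionGaloisModule (p ^ n : ℕ)) (Sum.inr vp) 1 x))) := by
  constructor
  · rintro ⟨x, hx, θ, hKS, hkim⟩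
    refine ⟨x, hx, ?_, hkim⟩
    have h := (ReciprocityPT.exists_addEquiv_apply_eq_iff_zmodPowOrd_eq hp.out φ ψℓ _ _).mp ⟨θ, hKS.symm⟩
    exact h.symm
  · rintro ⟨x, hx, hord, hkim⟩
    obtain ⟨θ, hθ⟩ := ReciprocityPT.exists_addEquiv_apply_eq_of_zmodPowOrd_eq hp.out φ ψℓ hord.symm
    exact ⟨x, hx, θ, hθ.symm, hkim⟩

end Intrinsic

/-! ### §3 Consumers (one line each from the sibling files) -/

section Consumers

variable (W : WeierstrassCurve ℚ) [W.IsElliptic] [W.IsGloballyMinimal] {N : ℕ} (f : CuspForm (Gamma0 N) 2)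
  (p ℓ : ℕ) [hp : Fact p.Prime] [Fact ℓ.Prime] (k : ℕ) (P : W.toAffine.Point) (F m : ℕ)

/-- **LAW-2 at `(ℓ, k)` from the datum** (any odd good non-anomalous `p`, any `m = m_p(P)`, derived regime):
`ord_p(δ̃_ℓ mod p^k) = min(k, F + 2·v_ℓ(P))` given the two named facts, the formal-level datum of `P`, a cyclic
Kolyvagin prime `ℓ` of depth `n ≥ k`, `u` with `p ∤ u`, `KolyvaginKimDatum W f p ℓ k n ((p^{m+F}·u)·P) vℓ vp ψ`, and
`m = 0 ∨ m + F + 2v_ℓ(P) < n` (`zmodPowOrd_kuriharaNumber_eq_of_kolyvaginClass`).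
[cite: MazurRubin2004, Thm. 3.2.4 and Thm. 5.2.12] [cite: Kim2022StructureSelmer, Thm. 3.13 and (5.3)] -/
theorem zmodPowOrd_kuriharaNumber_eq_of_kolyvaginKimDatum (hp2 : p ≠ 2)
    (hgood : ¬ (p : ℤ) ∣ minimalDiscriminantInt W) (hna : ¬ p ∣ W.reductionPointCount p)
    (hm1 : W.reductionPointCount p • Affine.Point.map (W' := W.toAffine) (Algebra.ofId ℚ ℚ_[p]) P ∈
      (W.baseChange ℚ_[p]).formalFiltration (m + 1))
    (hm2 : W.reductionPointCount p • Affine.Point.map (W' := W.toAffine) (Algebra.ofId ℚ ℚ_[p]) P ∉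
      (W.baseChange ℚ_[p]).formalFiltration (m + 2))
    (hcycℓ : IsCyclicKolyvaginLevel W p ℓ)
    {vℓ vp : HeightOneSpectrum (𝓞 ℚ)} (hvℓ : (ℓ : 𝓞 ℚ) ∈ vℓ.asIdeal) (hvp : (p : 𝓞 ℚ) ∈ vp.asIdeal)
    (hPT : poitouTate_sum_localTatePairing_eq_zero ℚ)
    (hEPℓ : localEulerPoincareCharacteristic (vℓ.adicCompletion ℚ))
    (hEPp : localEulerPoincareCharacteristic (vp.adicCompletion ℚ))
    (ψ : (q : ℕ) → (ZMod q)ˣ →* Multiplicative (ZMod (p ^ k)))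
    {n : ℕ} (hk : k ≤ n) (hKP : Kato.IsKolyvaginPrime W p n ℓ) {u : ℕ} (hu : ¬ p ∣ u)
    (hD : KolyvaginKimDatum W f p ℓ k n ((p ^ (m + F) * u) • P) vℓ vp ψ)
    (hreg : m = 0 ∨ m + F + 2 * localDivExponent W p ℓ P < n) :
    (haveI : NeZero ℓ := ⟨(Fact.out : ℓ.Prime).ne_zero⟩
     zmodPowOrd p k (kuriharaNumber f (p ^ k) ℓ ψ)) = min k (F + 2 * localDivExponent W p ℓ P) := by
  obtain ⟨x, hx, θ, hKS, hkim⟩ := hD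
  exact zmodPowOrd_kuriharaNumber_eq_of_kolyvaginClass W f p ℓ k P F m hp2 hgood hna hm1 hm2 hcycℓ hvℓ hvp hPT
    hEPℓ hEPp ψ ⟨n, hk, hKP, u, hu, x, hx, θ, hKS, hreg, hkim⟩

/-- **C-16's clause at `(ℓ, k)` on its letter from the datum** (`p = 3`, `m₃(P) = 0`): the two named facts, the
letter clauses, and per surjective `ψ` a depth `n ≥ k` with `ℓ ∈ 𝒫_n`, `u` with `3 ∤ u` and
`KolyvaginKimDatum W f 3 ℓ k n ((3^F·u)·P) vℓ v₃ ψ` give `KuriharaExactOrderAt W f ℓ k P F`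
(`kuriharaExactOrderAt_of_letter_kolyvaginClass`). [cite: MazurRubin2004, Thm. 3.2.4 and Thm. 5.2.12]
[cite: Kim2022StructureSelmer, Thm. 3.13 and (5.3)] -/
theorem kuriharaExactOrderAt_of_kolyvaginKimDatum
    (hgood : W.HasGoodReductionAtPrime 3) (ha1 : W.frobeniusTrace 3 ≠ 1) (ha2 : W.frobeniusTrace 3 ≠ -2)
    (hm0 : ¬ O5.PointLocallyThreeDivisibleAt W 3 P) (hcycℓ : IsCyclicKolyvaginLevel W 3 ℓ)
    {vℓ v₃ : HeightOneSpectrum (𝓞 ℚ)} (hvℓ : (ℓ : 𝓞 ℚ) ∈ vℓ.asIdeal) (hv₃ : ((3 : ℕ) : 𝓞 ℚ) ∈ v₃.asIdeal)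
    (hPT : poitouTate_sum_localTatePairing_eq_zero ℚ)
    (hEPℓ : localEulerPoincareCharacteristic (vℓ.adicCompletion ℚ))
    (hEP₃ : localEulerPoincareCharacteristic (v₃.adicCompletion ℚ))
    (h : ∀ ψ : (q : ℕ) → (ZMod q)ˣ →* Multiplicative (ZMod (3 ^ k)),
      (∀ q ∈ ℓ.primeFactors, Function.Surjective (ψ q)) →
        ∃ (n : ℕ) (_ : k ≤ n) (_ : Kato.IsKolyvaginPrime W 3 n ℓ) (u : ℕ) (_ : ¬ 3 ∣ u),
          KolyvaginKimDatum W f 3 ℓ k n ((3 ^ F * u) • P) vℓ v₃ ψ) :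
    KuriharaExactOrderAt W f ℓ k P F :=
  kuriharaExactOrderAt_of_letter_kolyvaginClass W f ℓ k P F hgood ha1 ha2 hm0 hcycℓ hvℓ hv₃ hPT hEPℓ hEP₃
    fun ψ hψ => by
      obtain ⟨n, hk, hKP, u, hu, x, hx, θ, hKS, hkim⟩ := h ψ hψ
      exact ⟨n, hk, hKP, u, hu, x, hx, θ, hKS, hkim⟩

/-- **C-16 (closed sentence) ⟸ Poitou–Tate over `ℚ` ∧ local Euler characteristic at every `ℚ_v` ∧ the Kolyvagin-class
datum quantified over C-16's letter** (`F = s + v₃ ∏ c_q`; places `vℓ ∋ ℓ`, `v₃ ∋ 3` passed to the core). The THREE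
displayed hypotheses are: two published theorems (Milne I 4.10(b)+2.3, I 2.8; typed named facts) and ONE open input
(Kato's Kolyvagin system + Kim's Thm. 3.13 at `p = 3`). Nothing asserted; C-16 stays OPEN.
[cite: MazurRubin2004, Thm. 3.2.4 and Thm. 5.2.12] [cite: Kim2022StructureSelmer, Thm. 3.13 and (5.3)]
[cite: MilneADT2006, Ch. I, Thm. 4.10(b) and Thm. 2.8] -/
theorem kuriharaExactOrderRankOneAtThree_of_kolyvaginKimDatum
    (hPT : poitouTate_sum_localTatePairing_eq_zero ℚ)
    (hEP : ∀ v : HeightOneSpectrum (𝓞 ℚ), localEulerPoincareCharacteristic (v.adicCompletion ℚ))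
    (hcore : ∀ (W : WeierstrassCurve ℚ) [W.IsElliptic] [W.IsGloballyMinimal],
      W.analyticRank = 1 →
      ∀ (P : W.toAffine.Point), ¬ IsOfFinAddOrder P →
        (∀ Q : W.toAffine.Point, ∃ n : ℤ, IsOfFinAddOrder (Q - n • P)) →
      (∀ T : W.toAffine.Point, 3 • T = 0 → T = 0) →
      W.HasSurjectiveModNGaloisRep 3 →
      W.HasGoodReductionAtPrime 3 → W.frobeniusTrace 3 ≠ 1 → W.frobeniusTrace 3 ≠ -2 →
      ¬ O5.PointLocallyThreeDivisibleAt W 3 P →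
      ∀ (q : ℚ) (s : ℕ), shaAn W = (q : ℂ) → padicValRat 3 q = s →
      ∀ {N : ℕ} [NeZero N] (D : ModularParametrizationData W N),
        ¬ (3 : ℤ) ∣ D.maninConstant →
        (∃ u : ℚ, ‖(u : ℚ_[3])‖ = 1 ∧ W.realPeriodRat = u * plusPeriod D.f) →
      ∀ (ℓ k : ℕ) [Fact ℓ.Prime], 1 ≤ k → Kato.IsKolyvaginPrime W 3 k ℓ →
        IsCyclicKolyvaginLevel W 3 ℓ →
      ∀ (vℓ v₃ : HeightOneSpectrum (𝓞 ℚ)), (ℓ : 𝓞 ℚ) ∈ vℓ.asIdeal → ((3 : ℕ) : 𝓞 ℚ) ∈ v₃.asIdeal →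
        ∀ ψ : (q : ℕ) → (ZMod q)ˣ →* Multiplicative (ZMod (3 ^ k)),
          (∀ q ∈ ℓ.primeFactors, Function.Surjective (ψ q)) →
            ∃ (n : ℕ) (_ : k ≤ n) (_ : Kato.IsKolyvaginPrime W 3 n ℓ) (u : ℕ) (_ : ¬ 3 ∣ u),
              KolyvaginKimDatum W D.f 3 ℓ k n ((3 ^ (s + padicValNat 3 W.tamagawaProduct) * u) • P) vℓ v₃ ψ) :
    KuriharaExactOrderRankOneAtThree :=
  kuriharaExactOrderRankOneAtThree_of_letter_kolyvaginClass hPT hEP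
    fun W _ _ hr P hP hgen htors hsurj hgood ha1 ha2 hm0 q s hq hs N _ D hManin hper ℓ k _ hk hKP hcyc vℓ v₃ hvℓ hv₃
      ψ hψ => by
      obtain ⟨n, hkn, hKPn, u, hu, x, hx, θ, hKS, hkim⟩ :=
        hcore W hr P hP hgen htors hsurj hgood ha1 ha2 hm0 q s hq hs D hManin hper ℓ k hk hKP hcyc vℓ v₃ hvℓ hv₃ ψ hψ
      exact ⟨n, hkn, hKPn, u, hu, x, hx, θ, hKS, hkim⟩

end Consumers

end Summit.BirchSwinnertonDyer.Rank1Residual.Ordinary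

end
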